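import Summits.BirchSwinnertonDyer.BirchSwinnertonDyer.Theorems.TwoAdicConverseBDPAcLineCoinvariantInfRes
import HarnessLib

/-!
# AC-LINE SPECIALISATION₂, the COINVARIANT DOOR (part I-b): control `X_Gr₂ ⧸ T₁ → 𝔛_ac` up to `p^m` from the exponent of the
# COINVARIANTS `E[p^∞]^{I′} ⧸ (φ − 1)`, `I′ = Gal(K̄/K̃_∞) ∩ I_{v̄}`, when a single `φ` topologically generates
# `Gal(K̄/K_∞^{(2)}) ∩ D_{v̄}` modulo `I′` (crux `BDPSelmerLowerDivisibilityAtTwo`, stmt-BirchSwinnertonDyer-24728; route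
# `TwoAdicConverse`, S3)

Helper file `--supports stmt-BirchSwinnertonDyer-24728` (cell `bsd-2adic`, seat `bsd-2adic-tower-1` GEN 54; key «COINVARIANT DOOR»,
director-bsd (661), pen RC-654 §(2)–(3), SUMMON 20260830T195425Z). THEOREMS ONLY (no definition, no named fact, no instance,
no `sorry`). Runs GEN 53's door (`…AcLineSpecialisationAtTwoControl`, p783595) on the coinvariant inflation–restriction of part
I-a (`…AcLineCoinvariantInfRes`): GEN 53's door reads the INVARIANT currency `hfixc` («`E[p^∞]^{I′}` has finite exponent» —
false for CM, Serre–Tate for non-CM); this one reads `hgen` («`φ` topologically generates `ker κ₂ ∩ D_{v̄}` modulo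
`I′ = pairKer κ₁ κ₂ ∩ I_{v̄}`» — on the habitat (β): `K̃_∞/K_∞^{(2)}` unramified above `v̄` and `D_{v̄}/I_{v̄}` procyclic on Frobenius)
and `hcoinv` («the `φ`-coinvariants of `E[p^∞]^{I′}` are killed by `p^c`» — elementary, part II).

* §3 `exists_pow_smul_mem_range_selmerAcToUnrSelmer₂_of_strictKernelExponent` — GEN 53 §3 with the AT-`v̄` step ABSTRACTED to
  «`res y` Greenberg at `v̄` over `K̃_∞` ⟹ `p^c • y` strict at `v̄` over `K_∞^{(2)}`» (`hker`), so that BOTH currencies (GEN 53's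
  `hfixc`: `strictKernelExponent_of_exponent`; this file's `hcoinv`: `strictKernelExponent_of_coinvExponent`) instantiate ONE proof
  (GLOBAL lift `hK`-free, AWAY verbatim, Bézout);
  ★ `exists_pow_smul_mem_range_selmerAcToUnrSelmer₂_of_coinvExponent` (any `W` over a number field with complex infinite places).
* §4 ★ `acLineControl_of_localCoinvExponent` — the `ℚ`-curve form: GEN 53's ★ `acLineControl_of_localExponent` with `hfixc`
  REPLACED by `(φ) (hφ : φ ∈ ker κ₂ ⊓ D_{v̄}) (hgen : ker κ₂ ⊓ D_{v̄} ≤ closure ⟨φ, pairKer κ₁ κ₂ ⊓ I_{v̄}⟩⁻)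
  (hcoinv : ∃ c, ∀ m ∈ E_K[p^∞]^{I′}, ∃ m' ∈ E_K[p^∞]^{I′}, p^c • m = φ • m' − m')`; conclusion = `hctl` VERBATIM.

HONEST LABELS: Galois-cohomological bookkeeping on CONSTRUCTED carriers; `hgen` and `hcoinv` are DISPLAYED hypotheses (part II
discharges `hcoinv` from an «ordinary shape» existential; `hgen` = «`Q` procyclic generated by `φ`» stays displayed); closes
nothing at the ∀-level; the count of record of O2 does not move (a door is not a discharge); U / R0G / ACPIN / OV16-print untouched;
BSD is proved for no curve by any of this; typed ≠ proved. References: Serre, *Local Fields* VII §6 Prop. 4 and XIII §1;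
Skinner–Urban, Invent. Math. 195 (2014) §3.2.7–3.2.8; Jetchev–Skinner–Wan, Camb. J. Math. 5 (2017) §3.4; Greenberg, LNM 1716
(1999) §3 Lemmas 3.1–3.3.
-/

-- D-0017: single-problem summit, the namespace repeats the problem name by design.
set_option linter.dupNamespace false
set_option autoImplicit false

noncomputable section

open scoped Classical

open NumberField IsDedekindDomain Field
open Literature.NumberTheory.EllipticCurves Literature.NumberTheory.GaloisRepresentations
  Literature.NumberTheory.EllipticCurves.GreenbergSelmer Literature.NumberTheory.EllipticCurves.GreenbergVatsal2000
  Literature.NumberTheory.EllipticCurves.Castella2018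
open Summit.BirchSwinnertonDyer.BirchSwinnertonDyer.Theorems.TameExactControl

namespace Summit.BirchSwinnertonDyer.BirchSwinnertonDyer.Theorems.TwoAdicBDPAcLineSpec

/-! ## §3. The `ℤ_p²`-tower over the anticyclotomic line: ONE proof for both currencies -/

section Tower

variable {K : Type} [Field K] [NumberField K] (W : WeierstrassCurve K) [W.IsElliptic] (p : ℕ) [Fact p.Prime]
  (κ₁ κ₂ : ZpExtension K p) (vbar : HeightOneSpectrum (𝓞 K)) {γ₁ γ₂ : absoluteGaloisGroup K}

/-- **CONTROL UP TO `p^m` FROM AN ABSTRACT KERNEL EXPONENT AT `v̄`** (GEN 53 §3 with the step AT `v̄` made a hypothesis, so that the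
invariant and the coinvariant currencies instantiate ONE proof). Let `W` be elliptic over a number field `K` all of whose infinite
places are complex, `(κ₁, κ₂; γ₁, γ₂)` a topological generator pair, `v̄ ∋ p`, and suppose (`hker`): for every
`y ∈ H¹(K_∞^{(2)}, E[p^∞])` whose restriction to `K̃_∞` satisfies Greenberg's inertia condition at `v̄` (strict datum), `p^c • y`
satisfies the STRICT condition at `v̄` over `K_∞^{(2)}`. Then there is `m` with `p^m · s ∈ range (selmerAcToUnrSelmer₂)` for every
`conj_{γ₁}`-fixed `s ∈ unrSelmer₂ κ₁ κ₂ E[p^∞] v̄`. GLOBAL (`hK`-free tower lift `exists_resOfLe_eq_of_conjSel₂_eq_of_pair`),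
AWAY (`I_v ≤ ker κ₁`, `TameExactControl.mem_unramifiedKer_of_resOfLe_mem`, sbc-p1's integer `t`) and Bézout VERBATIM as GEN 53.
[cite: SkinnerUrban2014, §3.2.7 and Prop. 3.2.8 (p. 23)] [cite: JetchevSkinnerWan2017, §3.4 (arXiv:1512.06894 pp. 14–15)]
[cite: GreenbergLNM1716, §3 Lemmas 3.1–3.3] -/
theorem exists_pow_smul_mem_range_selmerAcToUnrSelmer₂_of_strictKernelExponent
    (hγ : ZpExtension.IsTopGeneratorPair κ₁ κ₂ γ₁ γ₂)
    (hKc : ∀ w : InfinitePlace K, w.IsComplex) (hvbar : ((p : ℕ) : 𝓞 K) ∈ vbar.asIdeal)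
    (hker : ∃ c : ℕ, ∀ y : W.subgroupH1 p κ₂.kerSubgroup,
      resOfLe (W.geomPrimaryTorsion p) (ZpExtension.pairKer_le_right κ₁ κ₂) y ∈
          (AcSelmer.strictDatum (W.geomPrimaryTorsion p) vbar).greenbergKer (ZpExtension.pairKer κ₁ κ₂) →
        p ^ c • y ∈ (AcSelmer.strictDatum (W.geomPrimaryTorsion p) vbar).strictKer κ₂.kerSubgroup) :
    ∃ m : ℕ, ∀ s : unrSelmer₂ κ₁ κ₂ (W.geomPrimaryTorsion p) vbar,
      conjSel₂ κ₁ κ₂ (W.geomPrimaryTorsion p) vbar γ₁ s = s →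
        p ^ m • s ∈ Set.range (W.selmerAcToUnrSelmer₂ p κ₁ κ₂ vbar) := by
  have hp : p.Prime := Fact.out
  obtain ⟨c, hc⟩ := hker
  obtain ⟨t, ht0, ht⟩ := SignedBaseChangeAcDivAwayDiscrepancy.exists_nsmul_mem_selmerAc_of_mem_datumStrictSelmer
    W p κ₂ hKc hvbar
  have htc0 : t * p ^ c ≠ 0 := mul_ne_zero ht0 (pow_ne_zero c hp.ne_zero)
  refine ⟨(t * p ^ c).factorization p, fun s hs ↦ ?_⟩
  -- GLOBAL: `s = res y`, no hypothesis on `E(K)[p]`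
  obtain ⟨y, hy⟩ := exists_resOfLe_eq_of_conjSel₂_eq_of_pair W p κ₁ κ₂ vbar hγ s hs
  have hle := ZpExtension.pairKer_le_right κ₁ κ₂
  have hcomm : ∀ σ : absoluteGaloisGroup K, conjH1 (ZpExtension.pairKer κ₁ κ₂) (W.geomPrimaryTorsion p) σ
      (resOfLe (W.geomPrimaryTorsion p) hle y) = resOfLe (W.geomPrimaryTorsion p) hle
        (conjH1 κ₂.kerSubgroup (W.geomPrimaryTorsion p) σ y) := fun σ ↦ by
    rw [← AddMonoidHom.comp_apply, ← resOfLe_comp_conjH1_holds (M := W.geomPrimaryTorsion p) hle σ,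
      AddMonoidHom.comp_apply]
  have hsmem : resOfLe (W.geomPrimaryTorsion p) hle y ∈
      datumSelmer (ZpExtension.pairKer κ₁ κ₂) (W.geomPrimaryTorsion p) p
        (AcSelmer.bdpData (W.geomPrimaryTorsion p) p vbar) ∅ := by
    have : W.resOfLe p hle y ∈ unrSelmer₂ κ₁ κ₂ (W.geomPrimaryTorsion p) vbar := by rw [hy]; exact s.2
    exact this
  rw [mem_datumSelmer_iff, mem_unramifiedOutside_iff] at hsmem
  obtain ⟨hunr, hgr⟩ := hsmem
  -- `p^c • y` lies in Greenberg–Vatsal's STRICT group over `K_∞^{(2)}`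
  have hyStr : p ^ c • y ∈ datumStrictSelmer κ₂.kerSubgroup (W.geomPrimaryTorsion p) p
      (AcSelmer.bdpData (W.geomPrimaryTorsion p) p vbar) ∅ := by
    rw [mem_datumStrictSelmer_iff, mem_unramifiedOutside_iff]
    refine ⟨fun v _ hpv σ ↦ ?_, fun v hv σ ↦ ?_⟩
    · -- AWAY from `p`: the inertia groups of `K̃_∞` and `K_∞^{(2)}` at `v` agree (`I_v ≤ ker κ₁`)
      have hI : κ₂.kerSubgroup ⊓ inertia v ≤ ZpExtension.pairKer κ₁ κ₂ := by
        have hI1 : inertia v ≤ κ₁.kerSubgroup := by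
          have e : inertia v = (adicCompletionPrime K v).inertia (absoluteGaloisGroup K) :=
            (inertia_adicCompletionPrime_eq_map_absInertia K v).symm
          rw [e]
          exact ZpExtension.inertia_le_kerSubgroup_holds K p κ₁ hpv (adicCompletionPrime_mem_primesAbove K v)
        rintro x ⟨hx2, hxI⟩
        exact ZpExtension.mem_pairKer_iff.2 ⟨ZpExtension.mem_kerSubgroup.1 (hI1 hxI), ZpExtension.mem_kerSubgroup.1 hx2⟩
      rw [map_nsmul]
      refine AddSubgroup.nsmul_mem _ (mem_unramifiedKer_of_resOfLe_mem hle v hI ?_) _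
      rw [← hcomm]
      exact hunr v (Set.notMem_empty v) hpv σ
    · by_cases hvb : v = vbar
      · subst hvb
        rw [AcSelmer.bdpData_self p v hv, map_nsmul]
        refine hc _ ?_
        rw [← hcomm]
        have h2 := hgr v hv σ
        rwa [AcSelmer.bdpData_self p v hv] at h2
      · rw [AcSelmer.bdpData_of_ne p vbar hv hvb, AcSelmer.strictKer_relaxedDatum_eq_top]
        exact AddSubgroup.mem_top _
  -- `t • p^c • y ∈ Sel_{v̄}^∅(K_∞^{(2)})`, hence `(t · p^c) • s ∈ range(res)`
  have hty : t • (p ^ c • y) ∈ AcSelmer.selmerAc W p κ₂ vbar ∅ := ht _ hyStr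
  have hts : (t * p ^ c) • s ∈ Set.range (W.selmerAcToUnrSelmer₂ p κ₁ κ₂ vbar) := by
    refine ⟨⟨t • (p ^ c • y), hty⟩, Subtype.ext ?_⟩
    rw [WeierstrassCurve.coe_selmerAcToUnrSelmer₂_apply, AddSubgroup.coe_nsmul, map_nsmul, map_nsmul, hy,
      mul_smul]
  -- `s` is `p`-primary
  obtain ⟨k, hk⟩ : ∃ k : ℕ, p ^ k • s = 0 := by
    obtain ⟨k, hk⟩ := TwoVariableSelmer.exists_pow_smul_subgroupH1_pair_eq_zero κ₁ κ₂ (W.geomPrimaryTorsion p)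
      (W.exists_pow_smul_geomPrimaryTorsion_eq_zero p) (s : W.subgroupH1 p (ZpExtension.pairKer κ₁ κ₂))
    exact ⟨k, Subtype.ext (by rw [AddSubgroupClass.coe_nsmul]; exact hk)⟩
  exact exists_pow_smul_mem_of_nsmul_mem p (W.selmerAcToUnrSelmer₂ p κ₁ κ₂ vbar).range htc0 hk hts

omit [W.IsElliptic] in
/-- GEN 53's invariant-currency door is an instance of the abstract one: `hfixc` ⟹ `hker`
(`nsmul_mem_strictKer_strictDatum_of_resOfLe_mem_greenbergKer`). Recorded so that nothing of GEN 53 is orphaned by the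
abstraction. [cite: SkinnerUrban2014, Prop. 3.2.8 (p. 23)] -/
theorem strictKernelExponent_of_exponent
    (hfixc : ∃ c : ℕ, ∀ m : W.geomPrimaryTorsion p, (∀ x : absoluteGaloisGroup K,
      x ∈ ZpExtension.pairKer κ₁ κ₂ → x ∈ inertia vbar → x • m = m) → p ^ c • m = 0) :
    ∃ c : ℕ, ∀ y : W.subgroupH1 p κ₂.kerSubgroup,
      resOfLe (W.geomPrimaryTorsion p) (ZpExtension.pairKer_le_right κ₁ κ₂) y ∈
          (AcSelmer.strictDatum (W.geomPrimaryTorsion p) vbar).greenbergKer (ZpExtension.pairKer κ₁ κ₂) →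
        p ^ c • y ∈ (AcSelmer.strictDatum (W.geomPrimaryTorsion p) vbar).strictKer κ₂.kerSubgroup := by
  obtain ⟨c, hc⟩ := hfixc
  exact ⟨c, fun y hy ↦ nsmul_mem_strictKer_strictDatum_of_resOfLe_mem_greenbergKer
    (ZpExtension.pairKer_le_right κ₁ κ₂) vbar hc hy⟩

omit [W.IsElliptic] in
/-- **The coinvariant currency gives `hker`**: if `φ ∈ ker κ₂ ∩ D_{v̄}` topologically generates `ker κ₂ ∩ D_{v̄}` modulo
`I′ = pairKer κ₁ κ₂ ∩ I_{v̄}` and the `φ`-coinvariants of `E[p^∞]^{I′}` are killed by `p^c`, then «`res y` Greenberg at `v̄` over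
`K̃_∞`» ⟹ «`p^c • y` strict at `v̄` over `K_∞^{(2)}`» (§2 at `M = E[p^∞]`, continuous orbits `continuous_smul_geomPrimaryTorsion`).
[cite: SkinnerUrban2014, Prop. 3.2.8 (p. 23)] [cite: SerreLocalFields1979, XIII §1] -/
theorem strictKernelExponent_of_coinvExponent {φ : absoluteGaloisGroup K} (hφ : φ ∈ κ₂.kerSubgroup ⊓ decomp vbar)
    (hgen : κ₂.kerSubgroup ⊓ decomp vbar ≤ (Subgroup.closure ({φ} ∪
      ((ZpExtension.pairKer κ₁ κ₂ ⊓ inertia vbar : Subgroup (absoluteGaloisGroup K)) :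
        Set (absoluteGaloisGroup K)))).topologicalClosure)
    (hcoinv : ∃ c : ℕ, ∀ m : W.geomPrimaryTorsion p, (∀ x : absoluteGaloisGroup K,
      x ∈ ZpExtension.pairKer κ₁ κ₂ → x ∈ inertia vbar → x • m = m) → ∃ m' : W.geomPrimaryTorsion p,
        (∀ x : absoluteGaloisGroup K, x ∈ ZpExtension.pairKer κ₁ κ₂ → x ∈ inertia vbar → x • m' = m') ∧
          p ^ c • m = φ • m' - m') :
    ∃ c : ℕ, ∀ y : W.subgroupH1 p κ₂.kerSubgroup,
      resOfLe (W.geomPrimaryTorsion p) (ZpExtension.pairKer_le_right κ₁ κ₂) y ∈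
          (AcSelmer.strictDatum (W.geomPrimaryTorsion p) vbar).greenbergKer (ZpExtension.pairKer κ₁ κ₂) →
        p ^ c • y ∈ (AcSelmer.strictDatum (W.geomPrimaryTorsion p) vbar).strictKer κ₂.kerSubgroup := by
  obtain ⟨c, hc⟩ := hcoinv
  exact ⟨c, fun y hy ↦ nsmul_mem_strictKer_strictDatum_of_resOfLe_mem_greenbergKer_of_topGen
    (ZpExtension.pairKer_le_right κ₁ κ₂) vbar (W.continuous_smul_geomPrimaryTorsion p) hφ hgen hc hy⟩

/-- ★ **CONTROL UP TO `p^m` FROM THE COINVARIANT EXPONENT AT `v̄`** (any `W` elliptic over a number field with complex infinite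
places, ANY `p`, any generator pair, `v̄ ∋ p`): if `φ ∈ Gal(K̄/K_∞^{(2)}) ∩ D_{v̄}` topologically generates that group modulo
`I′ = Gal(K̄/K̃_∞) ∩ I_{v̄}` (`hgen`: on the habitat, «`K̃_∞/K_∞^{(2)}` unramified above `v̄`» + «`D_{v̄}/I_{v̄}` procyclic on
Frobenius») and the `φ`-coinvariants of `E[p^∞]^{I′}` are killed by `p^c` (`hcoinv`), then there is `m` such that every
`conj_{γ₁}`-fixed class of `H¹_{nr,v̄}(K̃_∞, E[p^∞])` has `p^m`-multiple in the range of the restriction from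
`Sel_{v̄}^∅(K_∞^{(2)}, E[p^∞])` — the hypothesis `hctl` of the specialisation `charIdeal_XAc_map_le_rat'`.
[cite: SkinnerUrban2014, §3.2.7 and Prop. 3.2.8 (p. 23)] [cite: JetchevSkinnerWan2017, §3.4 (arXiv:1512.06894 pp. 14–15)]
[cite: GreenbergLNM1716, §3 Lemmas 3.1–3.3] [cite: SerreLocalFields1979, XIII §1] -/
theorem exists_pow_smul_mem_range_selmerAcToUnrSelmer₂_of_coinvExponent
    (hγ : ZpExtension.IsTopGeneratorPair κ₁ κ₂ γ₁ γ₂)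
    (hKc : ∀ w : InfinitePlace K, w.IsComplex) (hvbar : ((p : ℕ) : 𝓞 K) ∈ vbar.asIdeal)
    {φ : absoluteGaloisGroup K} (hφ : φ ∈ κ₂.kerSubgroup ⊓ decomp vbar)
    (hgen : κ₂.kerSubgroup ⊓ decomp vbar ≤ (Subgroup.closure ({φ} ∪
      ((ZpExtension.pairKer κ₁ κ₂ ⊓ inertia vbar : Subgroup (absoluteGaloisGroup K)) :
        Set (absoluteGaloisGroup K)))).topologicalClosure)
    (hcoinv : ∃ c : ℕ, ∀ m : W.geomPrimaryTorsion p, (∀ x : absoluteGaloisGroup K,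
      x ∈ ZpExtension.pairKer κ₁ κ₂ → x ∈ inertia vbar → x • m = m) → ∃ m' : W.geomPrimaryTorsion p,
        (∀ x : absoluteGaloisGroup K, x ∈ ZpExtension.pairKer κ₁ κ₂ → x ∈ inertia vbar → x • m' = m') ∧
          p ^ c • m = φ • m' - m') :
    ∃ m : ℕ, ∀ s : unrSelmer₂ κ₁ κ₂ (W.geomPrimaryTorsion p) vbar,
      conjSel₂ κ₁ κ₂ (W.geomPrimaryTorsion p) vbar γ₁ s = s →
        p ^ m • s ∈ Set.range (W.selmerAcToUnrSelmer₂ p κ₁ κ₂ vbar) :=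
  exists_pow_smul_mem_range_selmerAcToUnrSelmer₂_of_strictKernelExponent W p κ₁ κ₂ vbar hγ hKc hvbar
    (strictKernelExponent_of_coinvExponent W p κ₁ κ₂ vbar hφ hgen hcoinv)

end Tower

/-! ## §4. The `ℚ`-curve form: the binder `hctl` at `(W.baseChange K, p, κ₁, κ₂, v̄, γ₁)` from `hgen` + `hcoinv` -/

section Rational

/-- ★ **AC-LINE CONTROL AT A GIVEN PAIR FROM THE LOCAL COINVARIANT EXPONENT** — the `ℚ`-curve form: `W/ℚ` elliptic, ANY
prime `p` (so `p = 2`), `K` imaginary quadratic, `(κ₁, κ₂; γ₁, γ₂)` a topological generator pair (habitat (β): `κ₂` in the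
second slot), `v̄ ∋ p`, `φ ∈ Gal(K̄/K_∞^{(2)}) ∩ D_{v̄}` topologically generating that group modulo `I′ = Gal(K̄/K̃_∞) ∩ I_{v̄}`
(`hgen`), and the `φ`-coinvariants of `E_K[p^∞]^{I′}` killed by `p^c` (`hcoinv`). Conclusion = the hypothesis `hctl` of
`TwoAdicBDPAcLineSpec.charIdeal_XAc_map_le_rat'` / of the budget file at that pair, VERBATIM — with NO `Surj`, NO `p ≠ 2`, NO
`E(K)[p] = 0`, NO `¬CM`, NO Serre–Tate. GEN 53's `acLineControl_of_localExponent` is the invariant currency (`hfixc`).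
[cite: SkinnerUrban2014, Prop. 3.2.8 (p. 23)] [cite: JetchevSkinnerWan2017, §3.4 (arXiv:1512.06894 pp. 14–15)]
[cite: GreenbergLNM1716, §3 Lemmas 3.1–3.3] [cite: SerreLocalFields1979, XIII §1] -/
theorem acLineControl_of_localCoinvExponent (W : WeierstrassCurve ℚ) [W.IsElliptic] (p : ℕ) [Fact p.Prime]
    (K : Type) [Field K] [NumberField K] (hK : IsImaginaryQuadratic K)
    (κ₁ κ₂ : ZpExtension K p) (γ₁ γ₂ : absoluteGaloisGroup K) [hγ : Fact (ZpExtension.IsTopGeneratorPair κ₁ κ₂ γ₁ γ₂)]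
    (vbar : HeightOneSpectrum (𝓞 K)) (hvbar : ((p : ℕ) : 𝓞 K) ∈ vbar.asIdeal)
    (φ : absoluteGaloisGroup K) (hφ : φ ∈ κ₂.kerSubgroup ⊓ decomp vbar)
    (hgen : κ₂.kerSubgroup ⊓ decomp vbar ≤ (Subgroup.closure ({φ} ∪
      ((ZpExtension.pairKer κ₁ κ₂ ⊓ inertia vbar : Subgroup (absoluteGaloisGroup K)) :
        Set (absoluteGaloisGroup K)))).topologicalClosure)
    (hcoinv : ∃ c : ℕ, ∀ m : (W.baseChange K).geomPrimaryTorsion p, (∀ x : absoluteGaloisGroup K,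
      x ∈ ZpExtension.pairKer κ₁ κ₂ → x ∈ inertia vbar → x • m = m) → ∃ m' : (W.baseChange K).geomPrimaryTorsion p,
        (∀ x : absoluteGaloisGroup K, x ∈ ZpExtension.pairKer κ₁ κ₂ → x ∈ inertia vbar → x • m' = m') ∧
          p ^ c • m = φ • m' - m') :
    ∃ m : ℕ, ∀ s : unrSelmer₂ κ₁ κ₂ ((W.baseChange K).geomPrimaryTorsion p) vbar,
      conjSel₂ κ₁ κ₂ ((W.baseChange K).geomPrimaryTorsion p) vbar γ₁ s = s →
        p ^ m • s ∈ Set.range ((W.baseChange K).selmerAcToUnrSelmer₂ p κ₁ κ₂ vbar) := by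
  haveI hEK : (W.baseChange K).IsElliptic := by rw [WeierstrassCurve.baseChange]; infer_instance
  haveI : IsTotallyComplex K := hK.2
  have hKc : ∀ w : InfinitePlace K, w.IsComplex := fun w ↦ IsTotallyComplex.isComplex w
  exact exists_pow_smul_mem_range_selmerAcToUnrSelmer₂_of_coinvExponent (W.baseChange K) p κ₁ κ₂ vbar hγ.out hKc
    hvbar hφ hgen hcoinv

end Rational

end Summit.BirchSwinnertonDyer.BirchSwinnertonDyer.Theorems.TwoAdicBDPAcLineSpec

end
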